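import Literature.AnabelianGeometry.EtaleTheta.Discharge.Sec3TemperedFrobenioidRigidOverBaseOfDataRigid
import Literature.AnabelianGeometry.EtaleTheta.Discharge.Sec5ConstantsDictionaryNoGoAtTowerCarriers
import Literature.AnabelianGeometry.EtaleTheta.TemperedFrobenioidOfThetaTwistTowerSmallIndex
import HarnessLib

/-!
# `DivisorDataRigid` is FALSE AS TYPED at the [EtTh] Def. 3.6 carrier of record — the ENGINE: a natural automorphism of the
# Def. 3.3 (iii) divisor data `Φ₀` fixing every principal divisor lifts to a non-trivial `DataAut` of `ofPowDiagonalBase`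

S. Mochizuki, *The étale theta function …*, Publ. RIMS **45** (2009) [MochizukiEtTh2009], Def. 3.3 (iii) p.299 (PDF p.73), Def. 3.6 (i)(ii)
pp.302–303 (PDF pp.76–77); Prop. 1.3 / Rmk. 1.3.1 p.247 (PDF p.21) (the cusps are LABELLED; their decomposition groups are pairwise distinct).
[cite: MochizukiEtTh2009, Def 3.6 p.303 (PDF p.77)]  S. Mochizuki, *The geometry of Frobenioids I* (2008) [MochizukiFrdI2008], Def. 2.4 (i)
(perfection, realification), Thm. 5.2 (model Frobenioids). [cite: MochizukiFrdI2008, Def. 2.4(i) p.47]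

abc-iut cell, layer L2 = [EtTh], seat abc-iut-L2-t12 (gen 12), KEY «¬DDR@CARRIER-OF-RECORD» (abc-iut-L2-lead gen 9 R1469, on abc-iut-f-193's
flag R1463 and cusp-swap witness ★ `TateTowerThetaTwist.exists_cuspSwap`).  THIS FILE = the carrier-generic ENGINE (theorems + 3 transport
definitions), for EVERY engine carrier `C := TemperedFrobenioid.ofPowDiagonalBase hpf P hD hD' hFSM R S` (abc-iut-L2-t3's Def. 3.6 (ii) engine:
`Φ(A) = im(Φ₀(F A)^pf → Φ₀(F A)^rlf)`, `B(A)` = pairs `(b, ξ)` with `Div_B = snd`):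
* `perfectionMapEquiv` — a monoid automorphism `σ` of `M` induces one of the perfection `M^pf` (`Perfection.map`, functorial);
* `pfImageEquiv` — `Φ₀(Y)^pf ≃ Φ(A)` (abc-iut-w6-d048's `PfImageWeak.mrangeRestrict_toRealification_bijective`), `pfImageAut σ A` — the
  transported automorphism of `C.divisorMonoid.obj A`; `pfImageAut_apply_mk`, `pull_pfImageEquiv` (the pull-backs of `Φ` lie over
  `Perfection.map (Φ₀(F f))`, `rlfMapWeak_comp_toRealification`);
* **`dataAut_of_phiZeroAut`-shape theorem `exists_dataAut_of_phiZeroAut`**: a family `σ_Y : Φ₀(Y) ≃* Φ₀(Y)` NATURAL under every `Φ₀(g)` and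
  FIXING EVERY PRINCIPAL DIVISOR (`σ_Y^gp (div₀ b) = div₀ b` for all `b ∈ B₀(Y)`) yields a `TemperedFrobenioid.DataAut C` (p527197) with
  `a := pfImageAut σ`, `b := id` — `Div_B`-compatibility through abc-iut-L2-t11's `TemperedFrobenioid.ΦgpToRlog_injective_weak`;
* **`not_divisorDataRigid_ofPowDiagonalBase_of_phiZeroAut`**: if moreover `σ` MOVES some element of some `Φ₀(F A)`, then
  `¬ C.DivisorDataRigid`;
* **`not_divisorDataRigid_temperedFrobenioidSmall_of_phiZeroAut`** — the same read at THE carrier of record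
  `ThetaTwistTowerSmallIndex.temperedFrobenioidSmall R S` (count file ★ p522025), ready for abc-iut-f-193's cusp swap (`exists_cuspSwap`:
  a natural `Div⁺`-automorphism of the ε-free theta tower's `Φ₀` over `id` fixing the divisor of every function and moving the cusp prime
  `(0,+)` — the tower's function monoid `B₀` does not separate the two cusp `ℤ_γ`-torsors).
HONEST LABEL: a DESIGN ARTEFACT of OUR class-(b) carrier (print excludes it: labelled cusps, Prop. 1.3 / Rmk. 1.3.1); the γ-translation part of
the census flag has a Φ-side (★ p528860) but no `Div_B`-compatible B-partner (W0 memo); refutable-as-typed-at-a-design-carrier ≠ refuted in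
print; p527197's displayed Prop `DivisorDataRigid` stays a hypothesis of the generic theorem; NO «¬RigidOverBase» is claimed (DDR is
sufficient, not necessary).  No instance, no notation, no sorry; nothing about [IUTchI] Cor. 5.3 / [EtTh] in print is asserted; no side taken
on [IUTchIII] Cor. 3.12; nothing here asserts abc proved or refuted; typed ≠ proved.
-/

noncomputable section

namespace Literature.AnabelianGeometry.EtaleTheta

open CategoryTheory Opposite Function Literature.AlgebraicGeometry.Frobenioids

namespace TemperedFrobenioid

namespace DivisorDataRigidRefutation

universe u₀ v₀ u v

/-! ## §1 Transport of a monoid automorphism to the perfection and to `Φ(A) = im(Φ₀^pf → Φ₀^rlf)` -/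

section Perf

variable {M : Type} [CommMonoid M]

/-- A monoid automorphism `σ` of `M` induces an automorphism of the perfection `M^pf` (functoriality of `Perfection.map`).
[cite: MochizukiFrdI2008, Def. 2.4(i) p.47] -/
def perfectionMapEquiv (σ : M ≃* M) :
    Literature.AlgebraicGeometry.Frobenioids.Perfection M ≃* Literature.AlgebraicGeometry.Frobenioids.Perfection M :=
  MonoidHom.toMulEquiv (Literature.AlgebraicGeometry.Frobenioids.Perfection.map σ.toMonoidHom) (Literature.AlgebraicGeometry.Frobenioids.Perfection.map σ.symm.toMonoidHom)
    (by
      rw [← Literature.AlgebraicGeometry.Frobenioids.Perfection.map_comp,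
        show σ.symm.toMonoidHom.comp σ.toMonoidHom = MonoidHom.id M from MonoidHom.ext fun x => σ.symm_apply_apply x,
        Literature.AlgebraicGeometry.Frobenioids.Perfection.map_id])
    (by
      rw [← Literature.AlgebraicGeometry.Frobenioids.Perfection.map_comp,
        show σ.toMonoidHom.comp σ.symm.toMonoidHom = MonoidHom.id M from MonoidHom.ext fun x => σ.apply_symm_apply x,
        Literature.AlgebraicGeometry.Frobenioids.Perfection.map_id])

/-- `perfectionMapEquiv σ` IS `Perfection.map σ`. [cite: MochizukiFrdI2008, Def. 2.4(i) p.47] -/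
@[simp] theorem perfectionMapEquiv_apply (σ : M ≃* M) (p : Literature.AlgebraicGeometry.Frobenioids.Perfection M) :
    perfectionMapEquiv σ p = Literature.AlgebraicGeometry.Frobenioids.Perfection.map σ.toMonoidHom p := rfl

end Perf

variable {D₀ : Type u₀} [Category.{v₀} D₀] {dm : DivisorMonoids.{u₀, v₀, 0} D₀}
  (hpf : ∀ Y : D₀ᵒᵖ, IsPerfFactorialCof (dm.Φ₀.obj Y)) {D : Type u} [Category.{v} D] (P : PowDiagonalBase dm D)
  (hD : IsConnected D) (hD' : IsTotallyEpimorphic D) (hFSM : IsOfFSMType D) (R S : (Dᵒᵖ ⥤ CommMonCat.{0}) → Prop)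

/-- `Φ₀(F A)^pf → Φ(A) := im(Φ₀(F A)^pf → Φ₀(F A)^rlf)` — the weak realification map, range-restricted, valued in the engine
carrier's divisor monoid `C.divisorMonoid.obj A` (so that it composes with the Def. 3.6 structure maps on the nose).
[cite: MochizukiFrdI2008, Def. 2.4(i) p.48] -/
def toPfImage (A : Dᵒᵖ) :
    Literature.AlgebraicGeometry.Frobenioids.Perfection (dm.Φ₀.obj (op (P.F.obj A.unop)) : Type) →*
      ((ofPowDiagonalBase hpf P hD hD' hFSM R S).divisorMonoid.obj A : Type) where
  toFun p := ⟨(hpf (op (P.F.obj A.unop))).weak.toRealification p, p, rfl⟩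
  map_one' := Subtype.ext (map_one _)
  map_mul' p q := Subtype.ext (map_mul _ p q)

/-- Underlying realification class of `toPfImage A p`. [cite: MochizukiFrdI2008, Def. 2.4(i) p.48] -/
@[simp] theorem coe_toPfImage (A : Dᵒᵖ) (p : Literature.AlgebraicGeometry.Frobenioids.Perfection (dm.Φ₀.obj (op (P.F.obj A.unop)) : Type)) :
    (toPfImage hpf P hD hD' hFSM R S A p).1 = (hpf (op (P.F.obj A.unop))).weak.toRealification p := rfl

/-- `toPfImage A` is bijective (`M^pf → M^rlf` is injective for weakly perf-factorial `M`, abc-iut-w6-d048's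
`PfImageWeak.toRealification_injective`; surjective onto the image by definition). [cite: MochizukiFrdI2008, Def. 2.4(i) p.48] -/
theorem toPfImage_bijective (A : Dᵒᵖ) : Bijective (toPfImage hpf P hD hD' hFSM R S A) := by
  refine ⟨fun p q h => PfImageWeak.toRealification_injective (hpf _).weak (congrArg Subtype.val h), fun x => ?_⟩
  obtain ⟨p, hp⟩ := x.2
  exact ⟨p, Subtype.ext hp⟩

/-- `Φ₀(F A)^pf ≃ Φ(A)`. [cite: MochizukiFrdI2008, Def. 2.4(i) p.48] -/
def pfImageEquiv (A : Dᵒᵖ) :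
    Literature.AlgebraicGeometry.Frobenioids.Perfection (dm.Φ₀.obj (op (P.F.obj A.unop)) : Type) ≃*
      ((ofPowDiagonalBase hpf P hD hD' hFSM R S).divisorMonoid.obj A : Type) :=
  MulEquiv.ofBijective (toPfImage hpf P hD hD' hFSM R S A) (toPfImage_bijective hpf P hD hD' hFSM R S A)

/-- `pfImageEquiv A` IS `toPfImage A`. [cite: MochizukiFrdI2008, Def. 2.4(i) p.48] -/
@[simp] theorem pfImageEquiv_apply (A : Dᵒᵖ) (p : Literature.AlgebraicGeometry.Frobenioids.Perfection (dm.Φ₀.obj (op (P.F.obj A.unop)) : Type)) :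
    pfImageEquiv hpf P hD hD' hFSM R S A p = toPfImage hpf P hD hD' hFSM R S A p := rfl

/-- **The pull-backs of `Φ` lie over `Perfection.map (Φ₀(F f))`** (through `pfImageEquiv`; `rlfMapWeak_comp_toRealification`).
[cite: MochizukiEtTh2009, Def 3.6 p.302 (PDF p.76)] -/
theorem pull_pfImageEquiv {A A' : D} (f : A ⟶ A')
    (p : Literature.AlgebraicGeometry.Frobenioids.Perfection (dm.Φ₀.obj (op (P.F.obj A')) : Type)) :
    pull (ofPowDiagonalBase hpf P hD hD' hFSM R S).divisorMonoid f (pfImageEquiv hpf P hD hD' hFSM R S (op A') p) =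
      pfImageEquiv hpf P hD hD' hFSM R S (op A)
        (Literature.AlgebraicGeometry.Frobenioids.Perfection.map (dm.Φ₀.map (P.F.map f).op).hom p) := by
  apply Subtype.ext
  exact DFunLike.congr_fun (rlfMapWeak_comp_toRealification dm.Φ₀ hpf (P.F.map f).op) p

/-- **The transported automorphism of `Φ(A)`** induced by a monoid automorphism `σ` of `Φ₀(F A)`: `Φ₀^pf ≃ Φ(A)` conjugating `σ^pf`.
[cite: MochizukiEtTh2009, Def 3.6 p.303 (PDF p.77)] -/
def pfImageAut (σ : ∀ Y : D₀ᵒᵖ, (dm.Φ₀.obj Y : Type) ≃* (dm.Φ₀.obj Y : Type)) (A : Dᵒᵖ) :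
    ((ofPowDiagonalBase hpf P hD hD' hFSM R S).divisorMonoid.obj A : Type) ≃*
      ((ofPowDiagonalBase hpf P hD hD' hFSM R S).divisorMonoid.obj A : Type) :=
  ((pfImageEquiv hpf P hD hD' hFSM R S A).symm.trans (perfectionMapEquiv (σ (op (P.F.obj A.unop))))).trans
    (pfImageEquiv hpf P hD hD' hFSM R S A)

/-- `pfImageAut σ A` on the class of `p ∈ Φ₀(F A)^pf` is the class of `σ^pf p`. [cite: MochizukiEtTh2009, Def 3.6 p.303 (PDF p.77)] -/
@[simp] theorem pfImageAut_apply (σ : ∀ Y : D₀ᵒᵖ, (dm.Φ₀.obj Y : Type) ≃* (dm.Φ₀.obj Y : Type)) (A : Dᵒᵖ)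
    (p : Literature.AlgebraicGeometry.Frobenioids.Perfection (dm.Φ₀.obj (op (P.F.obj A.unop)) : Type)) :
    pfImageAut hpf P hD hD' hFSM R S σ A (pfImageEquiv hpf P hD hD' hFSM R S A p) =
      pfImageEquiv hpf P hD hD' hFSM R S A
        (Literature.AlgebraicGeometry.Frobenioids.Perfection.map (σ (op (P.F.obj A.unop))).toMonoidHom p) := by
  rw [pfImageAut, MulEquiv.trans_apply, MulEquiv.trans_apply, MulEquiv.symm_apply_apply, perfectionMapEquiv_apply]

/-! ## §2 The `DataAut` with `a := pfImageAut σ`, `b := id`, and the refutation -/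

/-- **ENGINE**: a family of monoid automorphisms `σ_Y` of the Def. 3.3 (iii) divisor monoids `Φ₀(Y)`, NATURAL under every `Φ₀(g)` and
FIXING EVERY PRINCIPAL DIVISOR (`σ_Y^gp (div₀ b) = div₀ b`), yields an automorphism of the Def. 3.6 data of the engine carrier over `id_D`
(`TemperedFrobenioid.DataAut`, p527197) whose `Φ`-component is `pfImageAut σ` and whose `B`-component is the identity.
[cite: MochizukiEtTh2009, Def 3.6 p.303 (PDF p.77)] -/
theorem exists_dataAut_of_phiZeroAut (σ : ∀ Y : D₀ᵒᵖ, (dm.Φ₀.obj Y : Type) ≃* (dm.Φ₀.obj Y : Type))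
    (hσ : ∀ {Y Y' : D₀ᵒᵖ} (g : Y ⟶ Y') (x : dm.Φ₀.obj Y), σ Y' ((dm.Φ₀.map g).hom x) = (dm.Φ₀.map g).hom (σ Y x))
    (hfix : ∀ (Y : D₀ᵒᵖ) (b : dm.B₀.obj Y), MonGp.map (σ Y).toMonoidHom (dm.div₀ Y b) = dm.div₀ Y b) :
    ∃ τ : (ofPowDiagonalBase hpf P hD hD' hFSM R S).DataAut,
      (∀ A, τ.a A = pfImageAut hpf P hD hD' hFSM R S σ A) ∧ (∀ A, τ.b A = MulEquiv.refl _) := by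
  refine ⟨{ a := fun A => pfImageAut hpf P hD hD' hFSM R S σ A
            b := fun A => MulEquiv.refl _
            a_natural := fun {A A'} f x => ?_
            b_natural := fun _ _ => rfl
            divB_b := fun A u => ?_ }, fun A => rfl, fun A => rfl⟩
  · -- naturality of the `Φ`-component: both sides lie over `Perfection.map` of `σ ∘ Φ₀(F f) = Φ₀(F f) ∘ σ`
    obtain ⟨p, rfl⟩ := (pfImageEquiv hpf P hD hD' hFSM R S (op A')).surjective x
    rw [pull_pfImageEquiv, pfImageAut_apply, pfImageAut_apply, pull_pfImageEquiv, ← MonoidHom.comp_apply,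
      ← Literature.AlgebraicGeometry.Frobenioids.Perfection.map_comp, ← MonoidHom.comp_apply,
      ← Literature.AlgebraicGeometry.Frobenioids.Perfection.map_comp]
    exact congrArg (fun φ => pfImageEquiv hpf P hD hD' hFSM R S (op A) (Literature.AlgebraicGeometry.Frobenioids.Perfection.map φ p))
      (MonoidHom.ext fun y => hσ (P.F.map f).op y)
  · -- `Div_B`-compatibility with `b = id`: `a^gp` fixes the divisor class of every function, through the injective comparison
    -- `Φ(A)^gp → (Φ^{ℝ-log})^gp(A)` and `σ^gp (div₀ b) = div₀ b`
    change u.1.2 = MonGp.map (pfImageAut hpf P hD hD' hFSM R S σ A).toMonoidHom u.1.2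
    have key : u.1.2 = gpMap (toPfImage hpf P hD hD' hFSM R S A)
        (gpMap (Literature.AlgebraicGeometry.Frobenioids.Perfection.of _) (dm.div₀ (op (P.F.obj A.unop)) u.1.1)) := by
      apply (ofPowDiagonalBase hpf P hD hD' hFSM R S).ΦgpToRlog_injective_weak A
      rw [← u.2]
      change gpMap (((hpf (op (P.F.obj A.unop))).weak.toRealification).comp (Literature.AlgebraicGeometry.Frobenioids.Perfection.of _))
          (dm.div₀ (op (P.F.obj A.unop)) u.1.1) =
        gpMap (P.pfImage hpf A).subtype (gpMap _ (gpMap _ (dm.div₀ (op (P.F.obj A.unop)) u.1.1)))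
      rw [← gpMap_comp_apply'', ← gpMap_comp_apply'']
      rfl
    have hcomp : ((pfImageAut hpf P hD hD' hFSM R S σ A).toMonoidHom.comp (toPfImage hpf P hD hD' hFSM R S A)).comp
          (Literature.AlgebraicGeometry.Frobenioids.Perfection.of _) =
        ((toPfImage hpf P hD hD' hFSM R S A).comp (Literature.AlgebraicGeometry.Frobenioids.Perfection.of _)).comp
          (σ (op (P.F.obj A.unop))).toMonoidHom := by
      refine MonoidHom.ext fun m => ?_
      change pfImageAut hpf P hD hD' hFSM R S σ A (pfImageEquiv hpf P hD hD' hFSM R S A (Literature.AlgebraicGeometry.Frobenioids.Perfection.of _ m)) =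
        pfImageEquiv hpf P hD hD' hFSM R S A (Literature.AlgebraicGeometry.Frobenioids.Perfection.of _ (σ (op (P.F.obj A.unop)) m))
      rw [pfImageAut_apply]
      rfl
    conv_rhs => rw [key, ← gpMap_eq_monGpMap, ← gpMap_comp_apply'', ← gpMap_comp_apply'', hcomp, gpMap_comp_apply'',
      gpMap_comp_apply'', gpMap_eq_monGpMap (σ (op (P.F.obj A.unop))).toMonoidHom, hfix]
    exact key

/-- **`DivisorDataRigid` FAILS at the engine carrier** as soon as such a `σ` MOVES one element of one `Φ₀(F A)`.
[cite: MochizukiEtTh2009, Def 3.6 p.303 (PDF p.77)] -/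
theorem not_divisorDataRigid_ofPowDiagonalBase_of_phiZeroAut (σ : ∀ Y : D₀ᵒᵖ, (dm.Φ₀.obj Y : Type) ≃* (dm.Φ₀.obj Y : Type))
    (hσ : ∀ {Y Y' : D₀ᵒᵖ} (g : Y ⟶ Y') (x : dm.Φ₀.obj Y), σ Y' ((dm.Φ₀.map g).hom x) = (dm.Φ₀.map g).hom (σ Y x))
    (hfix : ∀ (Y : D₀ᵒᵖ) (b : dm.B₀.obj Y), MonGp.map (σ Y).toMonoidHom (dm.div₀ Y b) = dm.div₀ Y b)
    (hne : ∃ (A : D) (x : dm.Φ₀.obj (op (P.F.obj A))), σ _ x ≠ x) :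
    ¬ (ofPowDiagonalBase hpf P hD hD' hFSM R S).DivisorDataRigid := by
  intro hrig
  obtain ⟨τ, hτa, -⟩ := exists_dataAut_of_phiZeroAut hpf P hD hD' hFSM R S σ hσ hfix
  obtain ⟨A, x, hx⟩ := hne
  apply hx
  have h := (hrig τ).1 (op A) (pfImageEquiv hpf P hD hD' hFSM R S (op A) (Literature.AlgebraicGeometry.Frobenioids.Perfection.of _ x))
  rw [hτa, pfImageAut_apply] at h
  have h' := (pfImageEquiv hpf P hD hD' hFSM R S (op A)).injective h
  -- `Φ₀(F A) → Φ₀(F A)^pf` is injective (sharp, integral, saturated: the weakly perf-factorial hypothesis)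
  have hinj : Injective (Literature.AlgebraicGeometry.Frobenioids.Perfection.of (dm.Φ₀.obj (op (P.F.obj A)) : Type)) :=
    of_injective_of_isSharp_isIntegral_isSaturated (hpf _).weak.isDivisorial.isSharp
      (hpf _).weak.isDivisorial.isPreDivisorial.isIntegral (hpf _).weak.isDivisorial.isPreDivisorial.isSaturated
  exact hinj h'

end DivisorDataRigidRefutation

/-! ## §3 Read at THE carrier of record `temperedFrobenioidSmall R S` -/

namespace DivisorDataRigidRefutation

open Literature.AlgebraicGeometry.Frobenioids.QuasiTemperoid Literature.AnabelianGeometry.SemiGraphs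
  Literature.AnabelianGeometry.SemiGraphs.GaloisObjects LogDivisorModel LogDivisorModel.GaloisAction LogDivisorTower TateTowerKummerTwistRShear
  LogDivisorModel.TateTowerThetaTwist ThetaTwistTowerTempered ThetaTwistTowerSmallIndex

/-- **At the carrier of record** (`ThetaTwistTowerSmallIndex.temperedFrobenioidSmall R S`, the tempered Frobenioid under the §5 count file
★ p522025): any natural automorphism of `dmSmall.Φ₀` fixing every principal divisor and moving one element refutes
`TemperedFrobenioid.DivisorDataRigid` there — the socket for abc-iut-f-193's cusp swap `TateTowerThetaTwist.exists_cuspSwap`.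
[cite: MochizukiEtTh2009, Def 3.6 p.303 (PDF p.77)] -/
theorem not_divisorDataRigid_temperedFrobenioidSmall_of_phiZeroAut
    (R S : ((ConnectedPart (BTemp (Compat 3 thetaShear)))ᵒᵖ ⥤ CommMonCat.{0}) → Prop)
    (σ : ∀ Y : (CosetCat (Compat 3 thetaShear))ᵒᵖ, (dmSmall.Φ₀.obj Y : Type) ≃* (dmSmall.Φ₀.obj Y : Type))
    (hσ : ∀ {Y Y' : (CosetCat (Compat 3 thetaShear))ᵒᵖ} (g : Y ⟶ Y') (x : dmSmall.Φ₀.obj Y),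
      σ Y' ((dmSmall.Φ₀.map g).hom x) = (dmSmall.Φ₀.map g).hom (σ Y x))
    (hfix : ∀ (Y : (CosetCat (Compat 3 thetaShear))ᵒᵖ) (b : dmSmall.B₀.obj Y), MonGp.map (σ Y).toMonoidHom (dmSmall.div₀ Y b) = dmSmall.div₀ Y b)
    (hne : ∃ (A : ConnectedPart (BTemp (Compat 3 thetaShear))) (x : dmSmall.Φ₀.obj (op (equivConn.inverse.obj A))), σ _ x ≠ x) :
    ¬ (temperedFrobenioidSmall R S).DivisorDataRigid :=
  not_divisorDataRigid_ofPowDiagonalBase_of_phiZeroAut hpfSmall powDiagonalBaseSmall _ _ _ R S σ hσ hfix hne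

end DivisorDataRigidRefutation

end TemperedFrobenioid

end Literature.AnabelianGeometry.EtaleTheta

end
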